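import Literature.AnabelianGeometry.AbsoluteAnabelian.AbsTopISemiAbsoluteProofs
import Literature.AnabelianGeometry.AbsoluteAnabelian.NFGaloisNotTFGProofs
import HarnessLib

/-!
# [AbsTopI] Thm 2.6 (vi) AS TYPED (`FundamentalExtension.Thm26vi`), discharged modulo its printed inputs

S. Mochizuki, *Topics in Absolute Anabelian Geometry I: Generalities* (2012) [AbsTopI], Thm 2.6
(vi), manuscript p. 22 (lit key `paper:url-11ac98ba15fc`), with its proof, p. 23 ll. 7–10:

  "In a similar vein, assertion (vi) follows immediately from the fact that `T_l(A)/G = 0` [again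
   a consequence of the "Riemann hypothesis for abelian varieties over finite fields"], together
   with the fact that `G` is very elastic [cf. Theorem 1.7, (iii)]."

Proof-only companion (no definitions, no named facts) of abc-iut-L4-t4's statement file
`AbsTopISemiAbsolute.lean`, where Thm 2.6 (vi) is the predicate `E.Thm26vi` on an abstract
extension `1 → Δ → Π → G → 1`:
  (1) every continuous homomorphism `Π → ℤ_l` kills `Δ` ("`Π^{ab-t} ↠ G^{ab-t}` is an
      isomorphism");
  (2) `Δ` is the maximal topologically finitely generated closed normal subgroup of `Π`
      (`E.GeomIsMaxTFGNormalIn ⊤`);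
  (3) `Π` is not topologically finitely generated.

HERE, for EVERY `E : FundamentalExtension.{0}` with number-field base data `B : E.NFBase`
(`G ≅ G_F`), the three conjuncts are derived from the printed inputs BY NAME:
* (1) from the group-theoretic content of "`T_l(A)/G = 0`": every `Π`-invariant continuous
  character `Δ → ℤ_l` is trivial (hypothesis `hT`, stated in existing vocabulary; for an extension
  arising from a variety over a number field it is the vanishing of the `G`-coinvariants of the
  `l`-adic Tate module of the Albanese, i.e. Weil's Riemann hypothesis over the residue fields —
  not an [IUTchI–IV]-cited item, hence a hypothesis and a GAP-LEDGER row, not a named fact);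
* (2) from [AbsAnab] Thm 1.1.2 (`galoisNF_tfgNormalSubgroup_trivial`, FACT-LIST F-0031, the
  content of "`G` is very elastic" used here) and `Δ` topologically finitely generated (Prop 2.2,
  `E.GeomTFG`), via the landed `thm26_vi_maximal_of_tfgNormalSubgroup_trivial`;
* (3) UNCONDITIONALLY, via the landed `thm26_vi_not_tfg_holds` (`G_F` is not topologically
  finitely generated).

Consumer: abc-iut-L4-t6's `AbsTopII/Remark332Proofs.rmk_3_3_2_of_thm26vi : Rmk_3_3_2 {E | E.Thm26vi}`.
HONEST FRAMING: [AbsTopI] is a refereed, undisputed paper; nothing here bears on [IUTchIII]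
Cor. 3.12; typed ≠ proved elsewhere; the two named inputs stay explicit hypotheses.
-/

noncomputable section

open Topology

namespace Literature.AnabelianGeometry.AbsoluteAnabelian

namespace FundamentalExtension

variable (E : FundamentalExtension.{0})

/-- **[AbsTopI] Thm 2.6 (vi), first sentence** ("the natural surjection `Π^{ab-t} ↠ G^{ab-t}` is an
isomorphism"), as typed: every continuous homomorphism `φ : Π → ℤ_l` kills `Δ` — GIVEN the
group-theoretic content of "`T_l(A)/G = 0`" (proof, p. 23): every `Π`-invariant continuous character
`Δ → ℤ_l` is trivial.  (The restriction `φ|_Δ` is such a character, `ℤ_l` being commutative.)  Valid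
for every abstract extension. [cite: MochizukiAbsTopI2012, Thm 2.6 (vi) p.22] -/
theorem geom_le_ker_of_invariantCharacters_trivial (l : ℕ) [Fact l.Prime]
    (hT : ∀ ψ : E.geom →ₜ* Multiplicative ℤ_[l],
      (∀ (g : E.arith) (d d' : E.geom), (d' : E.arith) = g * d * g⁻¹ → ψ d' = ψ d) →
        ∀ d, ψ d = 1)
    (φ : E.arith →ₜ* Multiplicative ℤ_[l]) : E.geom ≤ φ.toMonoidHom.ker := by
  intro x hx
  -- the restriction of `φ` to `Δ`
  let ψ : E.geom →ₜ* Multiplicative ℤ_[l] :=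
    ⟨φ.toMonoidHom.comp E.geom.subtype, φ.continuous_toFun.comp continuous_subtype_val⟩
  have hψ : ∀ (g : E.arith) (d d' : E.geom), (d' : E.arith) = g * d * g⁻¹ → ψ d' = ψ d := by
    intro g d d' h
    change φ (d' : E.arith) = φ (d : E.arith)
    rw [h, map_mul, map_mul, map_inv, mul_comm (φ g) (φ d), mul_assoc, mul_inv_cancel, mul_one]
  have h1 := hT ψ hψ ⟨x, hx⟩
  rw [MonoidHom.mem_ker]
  exact h1

/-- **[AbsTopI] Thm 2.6 (vi) AS TYPED**, the printed deduction kernel-checked for EVERY extension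
`1 → Δ → Π → G → 1` of profinite groups with `G ≅ G_F`, `F` a number field: GIVEN
(a) `Δ` topologically finitely generated ([AbsTopI] Prop 2.2, `E.GeomTFG`),
(b) [AbsAnab] Thm 1.1.2 (`galoisNF_tfgNormalSubgroup_trivial`; print: "`G` is very elastic
    [Thm 1.7 (iii)]"), and
(c) the group-theoretic content of "`T_l(A)/G = 0`" [Riemann hypothesis for abelian varieties over
    finite fields]: for every prime `l`, every `Π`-invariant continuous character `Δ → ℤ_l` is trivial,
the predicate `E.Thm26vi` holds: `Π^{ab-t} ↠ G^{ab-t}` is an isomorphism, `Δ` is the maximal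
topologically finitely generated closed normal subgroup of `Π`, and `Π` is not topologically finitely
generated (the last clause unconditionally, `thm26_vi_not_tfg_holds`).
[cite: MochizukiAbsTopI2012, Thm 2.6 (vi) p.22] -/
theorem thm26vi_of_tfgNormalSubgroup_trivial (B : E.NFBase) (hΔ : E.GeomTFG)
    (h112 : galoisNF_tfgNormalSubgroup_trivial)
    (hT : ∀ (l : ℕ) [Fact l.Prime] (ψ : E.geom →ₜ* Multiplicative ℤ_[l]),
      (∀ (g : E.arith) (d d' : E.geom), (d' : E.arith) = g * d * g⁻¹ → ψ d' = ψ d) →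
        ∀ d, ψ d = 1) :
    E.Thm26vi := by
  refine ⟨fun l _ φ => E.geom_le_ker_of_invariantCharacters_trivial l (hT l) φ, ?_, ?_⟩
  · exact thm26_vi_maximal_of_tfgNormalSubgroup_trivial h112 E B hΔ
  · exact thm26_vi_not_tfg_holds E B

/-- The typed form (1) of "`Π^{ab-t} ↠ G^{ab-t}` is an isomorphism" is EQUIVALENT to hypothesis (c)
restricted to characters that extend to `Π`: conversely, if every continuous `φ : Π → ℤ_l` kills `Δ`,
then every continuous character of `Δ` that is the restriction of a continuous character of `Π` is
trivial — recorded so that the shape of (c) is seen to be the honest one (for characters of `Δ` that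
do NOT extend, (c) is genuinely stronger: it is the vanishing of `Hom_G(Δ^{ab}, ℤ_l)`, i.e. of
`T_l(A)/G`, as in print). [cite: MochizukiAbsTopI2012, Thm 2.6 (vi) p.22] -/
theorem restrict_eq_one_of_geom_le_ker (l : ℕ) [Fact l.Prime]
    (h : ∀ φ : E.arith →ₜ* Multiplicative ℤ_[l], E.geom ≤ φ.toMonoidHom.ker)
    (φ : E.arith →ₜ* Multiplicative ℤ_[l]) (d : E.geom) : φ (d : E.arith) = 1 := by
  have := h φ d.2
  rwa [MonoidHom.mem_ker] at this

end FundamentalExtension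

end Literature.AnabelianGeometry.AbsoluteAnabelian
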